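import Summits.Ventures.PercRepro.RankLevelSetDeleteMonoThree

/-!
# PercRepro — THE GIRTH RULE: the contraction door at a point of a shortest circuit (night-1, gen 12)

The three single-element doors of `RankLevelSetDeleteMonoThree` — (MD′) `σ_{M ＼ e}(p, q) ≤ σ_M(p, q)`, (MC)
`σ_{M ／ e}(p − 1, q) ≤ σ_M(p, q)`, (MC″) `σ_{M ／ e}(p − 1, q − 1) ≤ σ_M(p, q)` — are needed at SOME element of every
simple coloop-free core above the tight layer (`c025_of_threeWayMonoExistsCore`).  Census of this gen (own exact code;
dossier §22.7): at EVERY element lying on a circuit of minimum size (a «girth point») all three doors hold — on every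
core with ≤ 9 elements, on all 146,841,804 core-cells of the 54,404,724 single-element principal extensions to 10
elements (901,315,702 girth points, kit j251719), on random binary matroids of rank `q + 2` to 21 elements and on
truncated direct sums of uniform matroids to 17 elements — 0 failures.  This file names the weakest form the tree
consumes:

* **`ThmN.GirthContractDoorCore`** — every such core has a girth point `e` with (MC″);
* **`ThmN.c025_of_girthContractDoorCore : GirthContractDoorCore → C025`** — through the three-way door;
* `ThmN.GirthRuleCore` — the census-clean strong form: (MC″) at EVERY girth point of every such core;
* `ThmN.girthContractDoorCore_of_girthRuleCore` — the strong form implies the weak one (a core above the tight layer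
  has a circuit, hence a circuit of minimum size: `exists_min_isCircuit`);
* **`ThmN.c025_of_girthRuleCore : GirthRuleCore → C025`**.
Axioms: standard.
-/

open scoped Matroid

namespace PercRepro

namespace ThmN

open Set

variable {α : Type}

/-- `e` is a **girth point** of `M`: it lies on a circuit of minimum size. -/
def IsGirthPoint (M : Matroid α) (e : α) : Prop :=
  ∃ C, M.IsCircuit C ∧ e ∈ C ∧ ∀ C', M.IsCircuit C' → C.encard ≤ C'.encard

/-- **THE GIRTH RULE ON CORES (weak form)**: on every simple, rank-`p`, coloop-free core with every element
`e`-free-partitioned, `q ≥ 1`, `q + 2 ≤ p`, `|E| > p + q`, SOME girth point `e` satisfies (MC″):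
`σ_{M ／ e}(p − 1, q − 1) ≤ σ_M(p, q)`. -/
def GirthContractDoorCore : Prop :=
  ∀ {α : Type} (M : Matroid α) [M.Finite] (p q : ℕ), 1 ≤ q → q + 2 ≤ p →
    (∀ e ∈ M.E, ∀ f ∈ M.E, e ≠ f → M.eRk {e, f} = 2) → M.eRank = (p : ℕ∞) →
    (∀ e, ¬ M.IsColoop e) →
    (∀ e ∈ M.E, ∃ A ⊆ M.E \ {e}, e ∉ M.closure A ∧ e ∉ M.closure ((M.E \ {e}) \ A)) →
    p + q < M.E.ncard →
    ∃ e ∈ M.E, IsGirthPoint M e ∧ Matroid.slack (M ／ {e}) (p - 1) (q - 1) ≤ Matroid.slack M p q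

/-- **THE GIRTH RULE ON CORES (strong form, the census-clean statement)**: on every such core EVERY girth point
satisfies (MC″). -/
def GirthRuleCore : Prop :=
  ∀ {α : Type} (M : Matroid α) [M.Finite] (p q : ℕ), 1 ≤ q → q + 2 ≤ p →
    (∀ e ∈ M.E, ∀ f ∈ M.E, e ≠ f → M.eRk {e, f} = 2) → M.eRank = (p : ℕ∞) →
    (∀ e, ¬ M.IsColoop e) →
    (∀ e ∈ M.E, ∃ A ⊆ M.E \ {e}, e ∉ M.closure A ∧ e ∉ M.closure ((M.E \ {e}) \ A)) →
    p + q < M.E.ncard →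
    ∀ e ∈ M.E, IsGirthPoint M e → Matroid.slack (M ／ {e}) (p - 1) (q - 1) ≤ Matroid.slack M p q

/-- The weak girth rule implies the three-way door. -/
theorem threeWayMonoExistsCore_of_girthContractDoorCore (h : GirthContractDoorCore) :
    ThreeWayMonoExistsCore := by
  intro α M _ p q hq hpq hs hR hC hU hbig
  obtain ⟨e, he, -, hd⟩ := h M p q hq hpq hs hR hC hU hbig
  exact ⟨e, he, Or.inr (Or.inr hd)⟩

/-- **C-025 FROM THE GIRTH RULE (weak form).** -/
theorem c025_of_girthContractDoorCore (h : GirthContractDoorCore) : C025 :=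
  c025_of_threeWayMonoExistsCore (threeWayMonoExistsCore_of_girthContractDoorCore h)

/-- A finite matroid with a dependent set has a circuit of minimum size. -/
theorem exists_min_isCircuit (M : Matroid α) [M.Finite] {D : Set α} (hD : M.Dep D) :
    ∃ C, M.IsCircuit C ∧ ∀ C', M.IsCircuit C' → C.encard ≤ C'.encard := by
  classical
  obtain ⟨C₀, -, hC₀⟩ := hD.exists_isCircuit_subset
  have hfin : {C : Set α | M.IsCircuit C}.Finite :=
    (M.set_finite M.E).finite_subsets.subset (fun C hC => hC.subset_ground)
  have hne : ({C : Set α | M.IsCircuit C} : Set (Set α)).Nonempty := ⟨C₀, hC₀⟩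
  obtain ⟨C, hC, hmin⟩ := hfin.exists_minimalFor Set.encard _ hne
  refine ⟨C, hC, fun C' hC' => le_of_not_gt fun hlt => ?_⟩
  exact absurd (hmin hC' hlt.le) (not_le.2 hlt)

/-- A core strictly above the tight layer has a girth point: `E` itself is dependent (`|E| > p = r(E)`). -/
theorem exists_girthPoint_of_core (M : Matroid α) [M.Finite] {p q : ℕ} (hR : M.eRank = (p : ℕ∞))
    (hbig : p + q < M.E.ncard) : ∃ e ∈ M.E, IsGirthPoint M e := by
  have hEfin : M.E.Finite := M.set_finite M.E
  have hdep : M.Dep M.E := by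
    rw [M.dep_iff, and_iff_left rfl.subset]
    intro hind
    have h := hind.eRk_eq_encard
    rw [M.eRk_ground, hR, ← hEfin.cast_ncard_eq] at h
    have h' : p = M.E.ncard := by exact_mod_cast h
    omega
  obtain ⟨C, hC, hmin⟩ := exists_min_isCircuit M hdep
  obtain ⟨e, he⟩ := hC.nonempty
  exact ⟨e, hC.subset_ground he, C, hC, he, hmin⟩

/-- The strong girth rule implies the weak one. -/
theorem girthContractDoorCore_of_girthRuleCore (h : GirthRuleCore) : GirthContractDoorCore := by
  intro α M _ p q hq hpq hs hR hC hU hbig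
  obtain ⟨e, he, hg⟩ := exists_girthPoint_of_core M hR hbig
  exact ⟨e, he, hg, h M p q hq hpq hs hR hC hU hbig e he hg⟩

/-- **C-025 FROM THE GIRTH RULE (strong form).** -/
theorem c025_of_girthRuleCore (h : GirthRuleCore) : C025 :=
  c025_of_girthContractDoorCore (girthContractDoorCore_of_girthRuleCore h)

end ThmN

end PercRepro
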